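import Summits.HubbardSuperconductivity.HubbardSuperconductivity.Theorems.AnisotropyChordSpinMonotoneOneMagnonRegular
import Literature.Combinatorics.SimpleGraph.RankThreeStronglyRegular

/-!
# Route `AnisotropyChord`: the conjecture `U_vt` (`…SpinMonotoneDefs.VertexTransitiveCondensateMonotone`)
# HOLDS in its first non-trivial sector — one magnon on any connected vertex-transitive graph

A vertex-transitive graph is regular
(`Literature.Combinatorics.SimpleGraph.RankThreeStronglyRegular.isRegularOfDegree_of_isVertexTransitive`),
and on a connected regular graph the one-magnon sector ground state is the flat magnon with
condensate `Λ = 2|V| − 2` at EVERY anisotropy (`OneMagnon.oneMagnon_condensate_eq_of_regular`,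
file `…SpinMonotoneOneMagnonRegular`).  Hence the `M = |V|/2 − 1` slice of `U_vt` holds — stated below
literally as that slice (`vertexTransitive_oneMagnon_slice`).  Contrast: in the next sector (two
magnons) CONCAVITY already fails on the vertex-transitive `C₇`
(`TwoMagnon.not_vertexTransitive_condensate_concave`, file `…ConcavityCycleSeven`), while
monotonicity has no known counterexample (census of the same seat; theory seat
`hubbard-h0-rotor-theory-1`, cycle 4).  No definition is introduced.
-/

set_option linter.dupNamespace false

noncomputable section

namespace Summit.HubbardSuperconductivity.HubbardSuperconductivity.Theorems.AnisotropyChord.OneMagnon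

open Matrix Complex Finset
open Literature.MathematicalPhysics.QuantumLattice
open Literature.Combinatorics.SimpleGraph (IsVertexTransitive)
open Literature.Combinatorics.SimpleGraph.RankThreeStronglyRegular
  (isRegularOfDegree_of_isVertexTransitive)

variable {V : Type*} [Fintype V] [DecidableEq V] (G : SimpleGraph V) [DecidableRel G.Adj]

/-- **One magnon on a connected vertex-transitive graph**: the condensate of every normalised
sector ground state (sector `S^z_tot = |V|/2 − 1`) equals `2|V| − 2`, at every anisotropy `Δ`.
[folklore] -/
theorem vertexTransitive_oneMagnon_condensate_eq (hconn : G.Connected) (hvt : IsVertexTransitive G)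
    (Δ : ℝ) (ψ : (V → Fin 2) → ℂ)
    (hmem : ψ ∈ spinZSector (Λ := V) 1 ((Fintype.card V : ℝ) / 2 - 1)) (hnorm : star ψ ⬝ᵥ ψ = 1)
    (heig : (xxzHamiltonian 1 G (-1) Δ : Op V 2) *ᵥ ψ =
      ((lowestEnergyInSector 1 (xxzHamiltonian 1 G (-1) Δ) ((Fintype.card V : ℝ) / 2 - 1) : ℝ) : ℂ) • ψ) :
    (star ψ ⬝ᵥ (((∑ x, onSite x (spinRaise 1)) * (∑ y, onSite y (spinLower 1)) : Op V 2) *ᵥ ψ)).re =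
      2 * (Fintype.card V : ℝ) - 2 := by
  obtain ⟨v₀⟩ := hconn.nonempty
  exact oneMagnon_condensate_eq_of_regular G hconn (isRegularOfDegree_of_isVertexTransitive hvt v₀)
    Δ ψ hmem hnorm heig

/-- **`U_vt` holds in the one-magnon sector** (monotone — indeed constant — condensate): for
normalised one-magnon sector ground states `ψ₁` at `Δ₁` and `ψ₂` at `Δ₂` on a connected
vertex-transitive graph, `Λ(ψ₁) ≤ Λ(ψ₂)` (no restriction on `Δ₁, Δ₂`). [folklore] -/
theorem vertexTransitive_oneMagnon_condensate_monotone (hconn : G.Connected)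
    (hvt : IsVertexTransitive G) (Δ₁ Δ₂ : ℝ) (ψ₁ ψ₂ : (V → Fin 2) → ℂ)
    (h1m : ψ₁ ∈ spinZSector (Λ := V) 1 ((Fintype.card V : ℝ) / 2 - 1)) (h1n : star ψ₁ ⬝ᵥ ψ₁ = 1)
    (h1e : (xxzHamiltonian 1 G (-1) Δ₁ : Op V 2) *ᵥ ψ₁ =
      ((lowestEnergyInSector 1 (xxzHamiltonian 1 G (-1) Δ₁) ((Fintype.card V : ℝ) / 2 - 1) : ℝ) : ℂ) • ψ₁)
    (h2m : ψ₂ ∈ spinZSector (Λ := V) 1 ((Fintype.card V : ℝ) / 2 - 1)) (h2n : star ψ₂ ⬝ᵥ ψ₂ = 1)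
    (h2e : (xxzHamiltonian 1 G (-1) Δ₂ : Op V 2) *ᵥ ψ₂ =
      ((lowestEnergyInSector 1 (xxzHamiltonian 1 G (-1) Δ₂) ((Fintype.card V : ℝ) / 2 - 1) : ℝ) : ℂ) • ψ₂) :
    (star ψ₁ ⬝ᵥ (((∑ x, onSite x (spinRaise 1)) * (∑ y, onSite y (spinLower 1)) : Op V 2) *ᵥ ψ₁)).re ≤
      (star ψ₂ ⬝ᵥ (((∑ x, onSite x (spinRaise 1)) * (∑ y, onSite y (spinLower 1)) : Op V 2) *ᵥ ψ₂)).re := by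
  rw [vertexTransitive_oneMagnon_condensate_eq G hconn hvt Δ₁ ψ₁ h1m h1n h1e,
    vertexTransitive_oneMagnon_condensate_eq G hconn hvt Δ₂ ψ₂ h2m h2n h2e]

/-- **The one-magnon slice of `U_vt`, literally** (the statement
`…SpinMonotoneDefs.VertexTransitiveCondensateMonotone` with the sector specialised to
`M = |V|/2 − 1`; the hypotheses `−1 ≤ Δ₁ ≤ Δ₂ ≤ 1` are not even needed). [folklore] -/
theorem vertexTransitive_oneMagnon_slice :
    ∀ (V : Type) [Fintype V] [DecidableEq V] (G : SimpleGraph V) [DecidableRel G.Adj],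
      G.Connected → IsVertexTransitive G → ∀ (Δ₁ Δ₂ : ℝ), -1 ≤ Δ₁ → Δ₁ ≤ Δ₂ → Δ₂ ≤ 1 →
      ∀ ψ₁ ψ₂ : TensorIndex V 2 → ℂ,
        ψ₁ ∈ spinZSector (Λ := V) 1 ((Fintype.card V : ℝ) / 2 - 1) → star ψ₁ ⬝ᵥ ψ₁ = 1 →
        xxzHamiltonian 1 G (-1) Δ₁ *ᵥ ψ₁ =
          ((lowestEnergyInSector 1 (xxzHamiltonian 1 G (-1) Δ₁) ((Fintype.card V : ℝ) / 2 - 1) : ℝ) : ℂ) • ψ₁ →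
        ψ₂ ∈ spinZSector (Λ := V) 1 ((Fintype.card V : ℝ) / 2 - 1) → star ψ₂ ⬝ᵥ ψ₂ = 1 →
        xxzHamiltonian 1 G (-1) Δ₂ *ᵥ ψ₂ =
          ((lowestEnergyInSector 1 (xxzHamiltonian 1 G (-1) Δ₂) ((Fintype.card V : ℝ) / 2 - 1) : ℝ) : ℂ) • ψ₂ →
        (star ψ₁ ⬝ᵥ (((∑ x, onSite x (spinRaise 1)) * (∑ y, onSite y (spinLower 1)) : Op V 2) *ᵥ ψ₁)).re
          ≤ (star ψ₂ ⬝ᵥ (((∑ x, onSite x (spinRaise 1)) * (∑ y, onSite y (spinLower 1)) : Op V 2) *ᵥ ψ₂)).re := by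
  intro V _ _ G _ hconn hvt Δ₁ Δ₂ _ _ _ ψ₁ ψ₂ h1m h1n h1e h2m h2n h2e
  exact vertexTransitive_oneMagnon_condensate_monotone G hconn hvt Δ₁ Δ₂ ψ₁ ψ₂ h1m h1n h1e h2m h2n h2e

end Summit.HubbardSuperconductivity.HubbardSuperconductivity.Theorems.AnisotropyChord.OneMagnon
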